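import Summits.QuantumFields.YangMills.Theses.MirrorModularBoosts
import Summits.QuantumFields.YangMills.Theorems.MirrorModularBoostsHypercubicLimitOfWeakCoupling
import Summits.QuantumFields.YangMills.Theorems.PencilRigidityWeakCouplingHypercubicLimitOfScalingWindowSplit
import HarnessLib

/-!
# `MirrorModularBoosts.HypercubicLimit` (item stmt-QuantumFields-8646) from the three lattice items of route `ScalingWindowSplit`

Crux stmt-QuantumFields-8646 is the pre-re-type existence leg (`MirrorModularBoosts.HypercubicLimit`: no weak-coupling clause);
it is implied by its weak-coupling twin `CoincidenceRotationBootstrap.HypercubicLimit` (stmt-QuantumFields-16154, verbatim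
`MirrorModularBoosts.WeakCouplingHypercubicLimit`) through `hypercubicLimit_of_coincidenceRotationBootstrap` (p147954).  The
planners promoted the common lattice core of the twins as route `ScalingWindowSplit`, whose three crux items are
W₁ `GapAtCorrelationLength` (stmt-QuantumFields-18927), U_R `SelfNormalisedMomentBoundsR` (stmt-QuantumFields-18014) and
W₂ᴳ `SelfNormalisedSkewnessGapped` (stmt-QuantumFields-18170).  This file records, as tree theorems, that those three items close
item 8646 BY NAME — both through the route's typed split (`existenceLegFromLatticeGapped_proof`) and through the disjoint RP core
H16 (`stub_rpCoreDisjointOfSWS`, p163229; `hypercubicLimit_of_rpCoreDisjoint`, p149207) — and that H16 alone closes it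
(`hypercubicLimit_of_rpCoreDisjoint_8646`, the registered skeleton of 8646, reshape 6, in one term).  Pure composition of landed
theorems; it is the `--supports` landing of the registered stub `hypercubicLimit_of_scalingWindowSplit` of stmt-QuantumFields-8646.
-/

noncomputable section

open scoped SchwartzMap
open MeasureTheory Filter Topology
open Literature.MathematicalPhysics.AQFT Literature.MathematicalPhysics.QuantumLattice
open Literature.MathematicalPhysics.QuantumFieldTheory
open Summit.QuantumFields.YangMills.Cruxes.HypercubicLimit.CouplingResponse
  (PolyVolume UniformFunctionalBoundPlanes RPSpectral)

namespace Summit.QuantumFields.YangMills.Theorems.HypercubicLimit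

/-- **Item 8646 from the three `ScalingWindowSplit` items, through the route's typed split**: W₁ `GapAtCorrelationLength`,
U_R `SelfNormalisedMomentBoundsR`, W₂ᴳ `SelfNormalisedSkewnessGapped` ⇒ `CoincidenceRotationBootstrap.HypercubicLimit`
(`existenceLegFromLatticeGapped_proof`, stmt-18171) ⇒ `MirrorModularBoosts.HypercubicLimit` (forget `sch.HasWeakCouplingLimit`,
p147954). [folklore] -/
theorem hypercubicLimit_of_scalingWindowSplit :
    Summit.QuantumFields.YangMills.Theses.ScalingWindowSplit.GapAtCorrelationLength →
      Summit.QuantumFields.YangMills.Theses.ScalingWindowSplit.SelfNormalisedMomentBoundsR →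
        Summit.QuantumFields.YangMills.Theses.ScalingWindowSplit.SelfNormalisedSkewnessGapped →
          Summit.QuantumFields.YangMills.Theses.MirrorModularBoosts.HypercubicLimit :=
  fun hW hU hS =>
    hypercubicLimit_of_coincidenceRotationBootstrap
      (Summit.QuantumFields.YangMills.Theorems.ScalingWindowSplit.existenceLegFromLatticeGapped_proof hW hS hU)

/-- **Item 8646 from the disjoint RP core H16 alone** (the registered skeleton of stmt-8646, reshape 6, as one term): H16 ⇒ the
weak-coupling twin (`hypercubicLimit_of_rpCoreDisjoint`, p149207) ⇒ item 8646 (p147954).  H16 is the registered heart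
`stub_rpCoreDisjoint` of stmt-16154, stmt-16120 and stmt-8646. [folklore] -/
theorem hypercubicLimit_of_rpCoreDisjoint_8646
    (hcore : ∀ (G : Type) [Group G] [TopologicalSpace G] [IsTopologicalGroup G] [CompactSpace G]
      [MeasurableSpace G] [BorelSpace G], IsCompactSimpleLieGroup G →
      ∃ (r : LatticeRep G) (sch : SpeciesScheme (YMSpecies G)),
        sch.HasWeakCouplingLimit ∧ PolyVolume sch ∧
          Summit.QuantumFields.YangMills.Cruxes.HypercubicLimit.CouplingResponse.PolyRenorm r sch ∧
          UniformFunctionalBoundPlanes r sch ∧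
        (∃ Δ C : ℝ, 0 < Δ ∧ RPSpectral r sch Δ C) ∧
        (∃ (f g h : 𝓢(EuclideanSpace ℝ (Fin 4), ℝ)) (δ : ℝ),
          Disjoint (tsupport f) (tsupport g) ∧ Disjoint (tsupport f) (tsupport h) ∧
          Disjoint (tsupport g) (tsupport h) ∧ 0 < δ ∧
          ∀ᶠ k in atTop, δ ≤
            |latticeSchwinger r.ρ sch (fun s => s.F) k 3 (fun _ => r.curvature) ![f, g, h] -
              latticeSchwinger r.ρ sch (fun s => s.F) k 1 (fun _ => r.curvature) ![f] *
                latticeSchwinger r.ρ sch (fun s => s.F) k 2 (fun _ => r.curvature) ![g, h] -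
              latticeSchwinger r.ρ sch (fun s => s.F) k 1 (fun _ => r.curvature) ![g] *
                latticeSchwinger r.ρ sch (fun s => s.F) k 2 (fun _ => r.curvature) ![f, h] -
              latticeSchwinger r.ρ sch (fun s => s.F) k 1 (fun _ => r.curvature) ![h] *
                latticeSchwinger r.ρ sch (fun s => s.F) k 2 (fun _ => r.curvature) ![f, g] +
              2 * (latticeSchwinger r.ρ sch (fun s => s.F) k 1 (fun _ => r.curvature) ![f] *
                latticeSchwinger r.ρ sch (fun s => s.F) k 1 (fun _ => r.curvature) ![g] *
                latticeSchwinger r.ρ sch (fun s => s.F) k 1 (fun _ => r.curvature) ![h])|)) :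
    Summit.QuantumFields.YangMills.Theses.MirrorModularBoosts.HypercubicLimit :=
  hypercubicLimit_of_coincidenceRotationBootstrap
    (Summit.QuantumFields.YangMills.Theorems.WeakCouplingHypercubicLimit.TraceNormColdPressure.hypercubicLimit_of_rpCoreDisjoint
      hcore)

/-- **Item 8646 from the three `ScalingWindowSplit` items, through the heart** (cross-check: the square commutes at the level of
statements): W₁ → U_R → W₂ᴳ ⇒ H16 (`stub_rpCoreDisjointOfSWS`, p163229) ⇒ item 8646 (`hypercubicLimit_of_rpCoreDisjoint_8646`).
[folklore] -/
theorem hypercubicLimit_of_scalingWindowSplit' :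
    Summit.QuantumFields.YangMills.Theses.ScalingWindowSplit.GapAtCorrelationLength →
      Summit.QuantumFields.YangMills.Theses.ScalingWindowSplit.SelfNormalisedMomentBoundsR →
        Summit.QuantumFields.YangMills.Theses.ScalingWindowSplit.SelfNormalisedSkewnessGapped →
          Summit.QuantumFields.YangMills.Theses.MirrorModularBoosts.HypercubicLimit :=
  fun hW hU hS =>
    hypercubicLimit_of_rpCoreDisjoint_8646
      (Summit.QuantumFields.YangMills.Theorems.WeakCouplingHypercubicLimit.TraceNormColdPressure.stub_rpCoreDisjointOfSWS
        hW hU hS)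

end Summit.QuantumFields.YangMills.Theorems.HypercubicLimit

end
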